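import Literature.Probability.Percolation.AltFourArm
import HarnessLib

/-!
# Colour patterns of the order-free five-arm event `(T,F,T,F,F)`: separated and adjacent open arms

Topic `Literature/Probability/Percolation`; family `crit-perc`. The five-arm analogue of
`ArmPatternsFourArm.lean` (`armEvent_four_eq_alt_union_adj`), serving the named fact
`Nolin2008_thm24_fiveArm_upper` (`FiveArmExponentFacts.lean`; P. Nolin, EJP 13 (2008), §5.2
Thm. 24, five-arm item [arXiv 0711.4948: Thm. 23 (iii)]) and the stub `FiveArmUpperT` of the
tree, whose colour vector is `(T,F,T,F,F)` (two open and three closed arms, ORDER-FREE,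
`ArmEvents.lean`). Two cyclic arrangements of these colours exist (Nolin, §4.1: colour sequences
"up to cyclic permutation"): `BWBWW` — the two open arms separated by closed arms on both sides,
Nolin's `σ₅ = BWBBW` after the colour flip, the arrangement of the universal exponent's printed
proofs (Nolin §5.2; Kesten–Sidoravicius–Zhang 1998, `F(w, n)`; Werner 2009, `U_m(x)`: "the two
open paths are 'separated' by closed paths") — and `BBWWW`, the open arms adjacent, reached in
print only through the colour exchange of Nolin's Prop. 20 [arXiv Prop. 19]. As for four arms
(`altFourArm`, `adjFourArm`) the split is recorded in CLUSTER FORM, by excluded middle and without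
planar topology:

* `fiveArmSep r R` — the data of `armEvent ![T,F,T,F,F] r R` such that NO open path of the closed
  annulus `{r ≤ |·| ≤ R}` joins the two open arms (Werner's "separated"; it contains every family
  in the cyclic order `BWBWW`, since an open path between the open arms would cross a closed arm);
* `fiveArmAdj r R` — the data such that some open path of the closed annulus DOES join them (such
  a family is in the cyclic order `BBWWW`: the joining path and a closed arm of the same sector
  would meet);
* `armEvent_five_eq_sep_union_adj : armEvent ![T,F,T,F,F] r R = fiveArmSep r R ∪ fiveArmAdj r R`,
  `polyArmProb_five_le_sep_add_adj` — the union bound, and the trivial inclusions.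

The converse containments (cluster form ⟹ cyclic order, re-choosing arms by the Hex lemma in a
sector) are NOT claimed; as for `altFourArm`, the arm calculus consumes the cluster form.

## References

* P. Nolin, Near-critical percolation in two dimensions, *Electron. J. Probab.* 13 (2008)
  1562–1623, §4.1 (colour sequences up to cyclic permutation), §5.1 Prop. 20, §5.2 Thm. 24
  (arXiv 0711.4948: §4.1, Prop. 19, Thm. 23) [Nolin2008].
* W. Werner, *Lectures on two-dimensional critical percolation*, IAS/Park City Math. Ser. 16
  (2009), first exercise sheet, "Five-arm exponent", 2) ("The two open paths are 'separated' by
  closed paths") [WernerPCMI2009].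
* S. Smirnov, W. Werner, Math. Res. Lett. 8 (2001), §4 (`H_j(r,R)`: "prescribe colours … and their
  order … up to a multiplicative constant") [SmirnovWernerMRL2001].

## Mathlib / tree

Tree: `armEvent`, `IsColouredPath`, `polyArmProb` (`ArmEvents.lean`), `triAnn` (`AltFourArm.lean`),
`PathIn` (`SitePaths.lean`). Mathlib: `MeasureTheory.measureReal_union_le`.
-/

noncomputable section

open Set MeasureTheory

namespace Literature.Probability.Percolation

open LatticeModels

/-- **Five arms `(T,F,T,F,F)` with SEPARATED open arms, cluster form** (Werner 2009, ex. sheet,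
"Five-arm exponent", 2: "the two open paths are 'separated' by closed paths"; Nolin 2008, §4.1–§5.2,
`σ₅ = BWBBW` up to the colour flip): the data of `armEvent ![true, false, true, false, false] r R` —
five pairwise vertex-disjoint self-avoiding arms across `Λ_R ∖ Λ_r`, the arms `0, 2` open and
`1, 3, 4` closed — such that no open path of the closed annulus `{r ≤ |·| ≤ R}` joins a site of
the arm `0` to a site of the arm `2`. [cite: WernerPCMI2009, first exercise sheet, "Five-arm exponent", 2)] [cite: Nolin2008, §4.1 (arXiv 0711.4948, §4.1: colour sequences up to cyclic permutation)] -/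
def fiveArmSep (r R : ℕ) : Set (SiteConfig (Site 2)) :=
  {ω | ∃ (x y : Fin 5 → Site 2) (w : ∀ j, triGraph.Walk (x j) (y j)),
    (∀ j, x j ∈ triSphere r ∧ y j ∈ triSphere R ∧ (w j).IsPath ∧
      (∀ v ∈ (w j).support, v ∈ (↑(triBall R) : Set (Site 2)) \ ↑(triBall r) ∨ v ∈ triSphere r) ∧
      IsColouredPath ω (![true, false, true, false, false] j) (w j)) ∧
    (Pairwise fun i j => Disjoint (w i).support.toFinset (w j).support.toFinset) ∧
    (∀ u ∈ (w 0).support, ∀ v ∈ (w 2).support, ¬ PathIn triGraph (triAnn r R ∩ ω) u v)}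

/-- **Five arms `(T,F,T,F,F)` with ADJACENT (joined) open arms, cluster form**: the same data,
such that some open path of the closed annulus joins a site of the arm `0` to a site of the arm `2`
(the cyclic arrangement `BBWWW`, Nolin 2008, §4.1). [cite: Nolin2008, §4.1 (arXiv 0711.4948, §4.1: colour sequences up to cyclic permutation)] -/
def fiveArmAdj (r R : ℕ) : Set (SiteConfig (Site 2)) :=
  {ω | ∃ (x y : Fin 5 → Site 2) (w : ∀ j, triGraph.Walk (x j) (y j)),
    (∀ j, x j ∈ triSphere r ∧ y j ∈ triSphere R ∧ (w j).IsPath ∧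
      (∀ v ∈ (w j).support, v ∈ (↑(triBall R) : Set (Site 2)) \ ↑(triBall r) ∨ v ∈ triSphere r) ∧
      IsColouredPath ω (![true, false, true, false, false] j) (w j)) ∧
    (Pairwise fun i j => Disjoint (w i).support.toFinset (w j).support.toFinset) ∧
    (∃ u ∈ (w 0).support, ∃ v ∈ (w 2).support, PathIn triGraph (triAnn r R ∩ ω) u v)}

/-- The separated arrangement is contained in the order-free five-arm event. [cite: Nolin2008, §4.1] -/
theorem fiveArmSep_subset_armEvent (r R : ℕ) :
    fiveArmSep r R ⊆ armEvent ![true, false, true, false, false] r R := by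
  rintro ω ⟨x, y, w, hw, hdisj, -⟩
  exact ⟨x, y, w, hw, hdisj⟩

/-- The adjacent arrangement is contained in the order-free five-arm event. [cite: Nolin2008, §4.1] -/
theorem fiveArmAdj_subset_armEvent (r R : ℕ) :
    fiveArmAdj r R ⊆ armEvent ![true, false, true, false, false] r R := by
  rintro ω ⟨x, y, w, hw, hdisj, -⟩
  exact ⟨x, y, w, hw, hdisj⟩

/-- **The order-free five-arm event `(T,F,T,F,F)` is the union of its two arrangements**:
every family of five arms has its open arms either not joined or joined by an open path of the
closed annulus (excluded middle). [cite: SmirnovWernerMRL2001, §4 (H_j(r,R), p. 7 of arXiv math/0109120)] [cite: Nolin2008, §4.1] -/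
theorem armEvent_five_eq_sep_union_adj (r R : ℕ) :
    armEvent ![true, false, true, false, false] r R = fiveArmSep r R ∪ fiveArmAdj r R := by
  refine Subset.antisymm ?_
    (union_subset (fiveArmSep_subset_armEvent r R) (fiveArmAdj_subset_armEvent r R))
  rintro ω ⟨x, y, w, hw, hdisj⟩
  by_cases h : ∃ u ∈ (w 0).support, ∃ v ∈ (w 2).support, PathIn triGraph (triAnn r R ∩ ω) u v
  · exact Or.inr ⟨x, y, w, hw, hdisj, h⟩
  · refine Or.inl ⟨x, y, w, hw, hdisj, fun u hu v hv hp => h ⟨u, hu, v, hv, hp⟩⟩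

/-- **Union bound over the two arrangements**:
`P_{1/2}(armEvent (T,F,T,F,F) r R) ≤ P_{1/2}(fiveArmSep r R) + P_{1/2}(fiveArmAdj r R)`; with
Nolin's colour exchange (Prop. 20) the order-free five-arm upper bound thus reduces to the
separated arrangement. [cite: SmirnovWernerMRL2001, §4 (prescribing the order changes b_j up to a multiplicative constant)] [cite: Nolin2008, §5.1 Prop. 20 (arXiv 0711.4948: Prop. 19)] -/
theorem polyArmProb_five_le_sep_add_adj (r R : ℕ) :
    polyArmProb ![true, false, true, false, false] r R ≤
      (triSitePercolation half).real (fiveArmSep r R) + (triSitePercolation half).real (fiveArmAdj r R) := by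
  rw [polyArmProb, armEvent_five_eq_sep_union_adj]
  exact measureReal_union_le _ _

end Literature.Probability.Percolation
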